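import Summits.BirchSwinnertonDyer.BirchSwinnertonDyer.Theorems.ByReductionTypeAtTwoSupersingularFlatReciprocityConstantPrimitive
import Summits.BirchSwinnertonDyer.BirchSwinnertonDyer.Theorems.ByReductionTypeAtTwoSupersingularFlatReciprocityConstantHabitat
import Literature.NumberTheory.EllipticCurves.SkinnerUrban2014.PAdicUnitPeriodRatioAnyPrimeProofs
import Literature.NumberTheory.EllipticCurves.Rank1Residual.PeriodUnitProofs
import Literature.NumberTheory.EllipticCurves.Rank1Residual.Predicates
import Summits.BirchSwinnertonDyer.Rank1Residual.P2.EmptyCellsAtTwo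
import HarnessLib

/-!
# Crux `SupersingularRankZeroAtTwo` (K4, item stmt-BirchSwinnertonDyer-19097), line `odd_blind_package` v2.20, `stub_flatPackage`
# conjunct (8), F3b — FILE B1d of hand «(B1)♭-DECIDE»: (B1)♭′ IS PRINT — `v₂(ϖ) = 0` on the good-supersingular-at-`2` habitat
# modulo Abbes–Ullmo 1996 Thm. A, and the F3 doors with their `ϖ`-side hypothesis DISCHARGED by it

Seat `bsd-2adic-tower-1` GEN 70; the two-line composition is the pen's (bsd-2adic-plan GEN 41, RC-855, scratch
`plan/gen41/b1flat/FlatPeriodRatioNonnegOfAbbesUllmo.lean` @0ef3ff05ed7b19fa, farm-checked there), landed here under the hand's namespace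
with the two doors it feeds. HONEST FRAMING: theorems only (no definition, no named fact, no instance, no `sorry`); CONDITIONAL on the
EXISTING named print fact `abbesUllmo_not_dvd_maninConstant_of_not_dvd_level` [cite: AbbesUllmo1996, Thm. A] (already in the route's print
family: K1/K2 `periodTransferAtTwo_of_maninFacts`, `TowerClass.periodRatio_nonneg_of_irr_two_of_abbesUllmo`); helper toward conjunct (8)
F3b of `stub_flatPackage`; closes no stub and no item; 19097 OPEN; BSD₂ is proved for no supersingular curve and BSD for no curve.

## What

* ★ `padicValRat_periodRatio_eq_zero_of_goodSS_two_of_abbesUllmo` / `…_nonneg_…`: for globally minimal `W` with `GoodSS W 2`, its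
  newform `f` (any level) and every `ϖ : ℚ` with `ϖ·Ω(W) = Ω⁺_f` (the registered binder `(ϖ : ℝ) * W.realPeriodRat = plusPeriod f`,
  v2.20 :1640): `v₂(ϖ) = 0`, hence `0 ≤ v₂(ϖ)` — from the tree's `SkinnerUrban2014.realPeriodRat_eq_unit_mul_plusPeriod_two_of_abbesUllmo`
  (isogeny to the optimal curve + the `Ω(W)/Ω⁺_f` convention incl. real components, PROVED in Literature [cite: GreenbergVatsal2000, §3,
  Rem. 3.4]), `Rank1Residual.padicValRat_periodRatio_eq_zero_of_eq_unit_mul` and `P2.irr_two_of_goodSS_two` (`E[2]` irreducible at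
  good supersingular `2`).  So the (B1)♭′ display `hϖ : 0 ≤ padicValRat 2 ϖ` of v2.21 is a corollary of PRINT on the whole habitat.
* ★★★ `flatF3_package_of_levelCongruences_of_flatPrimitive_of_abbesUllmo`: the (U-inv) door (B1c) with `hϖ` DISCHARGED — binders: Z6's
  with `h2`, `t`, `ht` deleted, plus `hf : IsNewformOf W f`, `hϖΩ : (ϖ : ℝ) * W.realPeriodRat = plusPeriod f`, `hAU`, and
  `hprim : ∃ δ, (J (L (x δ))).2 ∉ Ideal.span {C 2}`; conclusion F3a ∧ F3b ∧ ZL2 VERBATIM.  After it, the `2`-adic residue of conjunct (8) F3b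
  is ♭-PRIMITIVITY ALONE.
* ★★ `flatF3_package_of_levelCongruences_of_abbesUllmo`: the same with Z6's `h2` kept (for a capstone that displays `h2`): Z6 with
  `(t, ht)` replaced by `hf`, `hϖΩ`, `hAU`.

References: [AbbesUllmo1996] A. Abbes, E. Ullmo, Compositio Math. 103 (1996), Thm. A; [AgasheRibetStein2006] Thm. 2.5; [GreenbergVatsal2000]
§3, Rem. 3.4; [Kato2004Asterisque] Thm. 12.4–12.6, §13.9–13.14; [Sprung2012] Def. 7.1, Thm. 7.14; [Sprung2017] Thm. 1.12, Cor. 4.4–4.5.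
-/

set_option autoImplicit false
-- the Theorems namespace of this sub repeats the summit name by design (D-0017 nested layout)
set_option linter.dupNamespace false

noncomputable section

open scoped Classical NumberField MatrixGroups ModularForm

open Polynomial

namespace Summit.BirchSwinnertonDyer.BirchSwinnertonDyer.Theorems

namespace SSFlatERL

open NumberField IsDedekindDomain WeierstrassCurve Literature.NumberTheory.EllipticCurves
  Literature.NumberTheory.EllipticCurves.ModularForms Literature.NumberTheory.EllipticCurves.SkinnerUrban2014
  Literature.NumberTheory.EllipticCurves.ZpExtension Literature.NumberTheory.EllipticCurves.Sprung2017
  Literature.NumberTheory.EllipticCurves.Kobayashi2003 Literature.NumberTheory.EllipticCurves.Sprung2012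
  Literature.NumberTheory.EllipticCurves.Rank1Residual Literature.NumberTheory.GaloisRepresentations CongruenceSubgroup
  SSFlatPackage

/-! ## §1 `v₂(ϖ) = 0` on the habitat, modulo Abbes–Ullmo -/

section Period

/-- ★ **`v₂(ϖ) = 0` for the period ratio `ϖ = Ω⁺_f/Ω(W)` on the good-supersingular-at-`2` habitat**, modulo Abbes–Ullmo Thm. A
(`2 ∤ N ⇒ 2 ∤ c₀`): `Ω(W) = u·Ω⁺_f` with `u` a `2`-adic unit (`realPeriodRat_eq_unit_mul_plusPeriod_two_of_abbesUllmo`, using `E[2]`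
irreducible from `P2.irr_two_of_goodSS_two`), hence `v₂(ϖ) = 0` (`padicValRat_periodRatio_eq_zero_of_eq_unit_mul`).  The pen's
composition (bsd-2adic-plan GEN 41, RC-855). [cite: AbbesUllmo1996, Thm. A] [cite: GreenbergVatsal2000, §3, Remark 3.4] -/
theorem padicValRat_periodRatio_eq_zero_of_goodSS_two_of_abbesUllmo
    (hAU : abbesUllmo_not_dvd_maninConstant_of_not_dvd_level)
    (W : WeierstrassCurve ℚ) [W.IsElliptic] [W.IsGloballyMinimal]
    (hss : GoodSS W 2) {N : ℕ} [NeZero N] (f : CuspForm (Gamma0 N) 2)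
    (hf : IsNewformOf W f) (ϖ : ℚ) (hϖ : (ϖ : ℝ) * W.realPeriodRat = plusPeriod f) :
    padicValRat 2 ϖ = 0 := by
  obtain ⟨u, hu, hΩ⟩ := realPeriodRat_eq_unit_mul_plusPeriod_two_of_abbesUllmo hAU W hss.1
    (Summit.BirchSwinnertonDyer.Rank1Residual.P2.irr_two_of_goodSS_two W hss) f hf
  exact Rank1Residual.padicValRat_periodRatio_eq_zero_of_eq_unit_mul W 2 f hu hΩ ϖ hϖ

/-- ★ **(B1)♭′ displayed: `0 ≤ v₂(ϖ)` on the good-supersingular-at-`2` habitat, modulo Abbes–Ullmo Thm. A** — the exact `hϖ`-side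
hypothesis of the doors `flatF3_package_of_levelCongruences_of_padicValRat_nonneg` (B1b) and `…_of_flatPrimitive` (B1c).
[cite: AbbesUllmo1996, Thm. A] [cite: GreenbergVatsal2000, §3, Remark 3.4] -/
theorem padicValRat_periodRatio_nonneg_of_goodSS_two_of_abbesUllmo
    (hAU : abbesUllmo_not_dvd_maninConstant_of_not_dvd_level)
    (W : WeierstrassCurve ℚ) [W.IsElliptic] [W.IsGloballyMinimal]
    (hss : GoodSS W 2) {N : ℕ} [NeZero N] (f : CuspForm (Gamma0 N) 2)
    (hf : IsNewformOf W f) (ϖ : ℚ) (hϖ : (ϖ : ℝ) * W.realPeriodRat = plusPeriod f) :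
    0 ≤ padicValRat 2 ϖ :=
  (padicValRat_periodRatio_eq_zero_of_goodSS_two_of_abbesUllmo hAU W hss f hf ϖ hϖ).ge

end Period

/-! ## §2 The F3 doors with the `ϖ`-side DISCHARGED by Abbes–Ullmo -/

section Habitat

variable (W : WeierstrassCurve ℚ) [W.IsElliptic] [W.IsGloballyMinimal] [ContinuousSMul ℤ_[2] (W.tateModule 2)]
  [Module.Free ℤ_[2] (W.tateModule 2)] [Module.Finite ℤ_[2] (W.tateModule 2)]
  {κ : ZpExtension ℚ 2} {γ : Field.absoluteGaloisGroup ℚ} (v : HeightOneSpectrum (𝓞 ℚ))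
  {g : Field.absoluteGaloisGroup (v.adicCompletion ℚ)} {c : ℕ → localPoints W (v.adicCompletion ℚ)}

/-- ★★★ **F3a ∧ F3b ∧ ZL2 OF CONJUNCT (8) FROM ♭-PRIMITIVITY ALONE (modulo Abbes–Ullmo).**  The (U-inv) door
`flatF3_package_of_levelCongruences_of_flatPrimitive` (B1c) with its `hϖ : 0 ≤ padicValRat 2 ϖ` DISCHARGED on the habitat: binders =
Z6's with `h2`, `t`, `ht` deleted, plus the newform relation `hf : IsNewformOf W f`, the registered period binder
`hϖΩ : (ϖ : ℝ) * W.realPeriodRat = plusPeriod f`, the print fact `hAU`, and `hprim : ∃ δ, (J (L (x δ))).2 ∉ Ideal.span {C 2}`;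
`(A, d)` in any normalisation; conclusion VERBATIM Z6's.  After this door the `2`-adic residue of F3b is «some Kato class of the family is
♭-primitive at `2`» and nothing else. [cite: AbbesUllmo1996, Thm. A] [cite: Kato2004Asterisque, Thm. 12.4 (2)(3), Thm. 12.5 (1)(4),
Thm. 12.6 (pp. 221–222), §13.9, §13.12–13.14 (pp. 230–234)] [cite: Sprung2012, Def. 7.1, Thm. 7.14, 7.16] [cite: Sprung2017, Thm. 1.12, Cor. 4.4–4.5] -/
theorem flatF3_package_of_levelCongruences_of_flatPrimitive_of_abbesUllmo
    (hAU : abbesUllmo_not_dvd_maninConstant_of_not_dvd_level) (hss : GoodSS W 2) (hκ : κ.IsCyclotomic)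
    (hγ : κ.IsTopGenerator γ)
    (hg : κ.IsTopGenerator (resGalOfEmb (closureEmb (K := ℚ) (v.adicCompletion ℚ)) g)) {ap : ℤ} (hap : (2 : ℤ) ∣ ap)
    (I : Kato2004.IwasawaH1Data W 2 κ γ) (hrank : Module.rank (IwasawaAlgebra 2) I.H ≤ 1)
    (L : letI := moduleOfGenerator κ (closureEmb (K := ℚ) (v.adicCompletion ℚ)) W hg
      I.H →ₗ[IwasawaAlgebra 2] (localTowerPointsOfEmb κ (closureEmb (K := ℚ) (v.adicCompletion ℚ)) W →+ ℤ_[2]))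
    (J : letI := moduleOfGenerator κ (closureEmb (K := ℚ) (v.adicCompletion ℚ)) W hg
      (localTowerPointsOfEmb κ (closureEmb (K := ℚ) (v.adicCompletion ℚ)) W →+ ℤ_[2]) →ₗ[IwasawaAlgebra 2]
        IwasawaAlgebra 2 × IwasawaAlgebra 2)
    (hJ : ∀ w, IsColemanPair κ (closureEmb (K := ℚ) (v.adicCompletion ℚ)) W ap g c w (J w).1 (J w).2)
    (P : Submodule (IwasawaAlgebra 2) (IwasawaAlgebra 2)) (loc : I.H →ₗ[IwasawaAlgebra 2] P)
    (hloc : ∀ x : I.H, (loc x : IwasawaAlgebra 2) = (J (L x)).2)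
    {N : ℕ} [NeZero N] (f : CuspForm (Gamma0 N) 2) (hf : IsNewformOf W f) (ϖ : ℚ)
    (hϖΩ : (ϖ : ℝ) * W.realPeriodRat = plusPeriod f)
    (Ls Lf : IwasawaAlgebra 2) (hL : IsSprungPair f 2 ap Ls Lf) (hLf : Lf ≠ 0)
    {ι : Type*} (x : ι → I.H) (A : ι → IwasawaAlgebra 2) {d : ℤ_[2]} (hd : d ≠ 0)
    (hE3 : ∀ (i : ι) (n : ℕ), ∃ (m : ℕ) (q : IwasawaAlgebra 2), PowerSeries.C ((2 : ℚ_[2]) ^ m) *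
        (iwasawaToPowerSeries 2 (A i) * (((mazurTateElement f 2 n).map (algebraMap ℚ ℚ_[2]) : ℚ_[2][X]) : PowerSeries ℚ_[2]) -
          iwasawaToPowerSeries 2 (PowerSeries.C d *
            pairingSum W (localTowerPointsOfEmb κ (closureEmb (K := ℚ) (v.adicCompletion ℚ)) W) g n (c n) (L (x i)))) =
      iwasawaToPowerSeries 2 ((((cyclotomicOmega 2 n).map (Int.castRingHom ℤ_[2]) : ℤ_[2][X]) : PowerSeries ℤ_[2]) * q))
    (hcop : ∀ 𝔭 : PrimeSpectrum (IwasawaAlgebra 2), 𝔭.asIdeal.height = 1 →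
      PowerSeries.C (2 : ℤ_[2]) ∉ 𝔭.asIdeal → ∃ i, A i ∉ 𝔭.asIdeal ∧
        Literature.NumberTheory.EllipticCurves.Kato2004.IsEulerSystemClassTwo W hκ I (x i) ∧ x i ≠ 0)
    (hprim : ∃ i, (J (L (x i))).2 ∉ Ideal.span {(PowerSeries.C (2 : ℤ_[2]) : IwasawaAlgebra 2)}) :
    ∃ (Z : Submodule (IwasawaAlgebra 2) I.H) (G : IwasawaAlgebra 2),
      G ∈ Submodule.map (P.subtype ∘ₗ loc) Z ∧
      iwasawaToPowerSeries 2 G = PowerSeries.C (ϖ : ℚ_[2]) * iwasawaToPowerSeries 2 Lf ∧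
      (∃ s₀ : I.H, Z = Submodule.span (IwasawaAlgebra 2) {s₀} ∧
        ∀ 𝔭 : PrimeSpectrum (IwasawaAlgebra 2), 𝔭.asIdeal.height = 1 →
          PowerSeries.C (2 : ℤ_[2]) ∉ 𝔭.asIdeal →
          ∃ (M : IwasawaAlgebra 2) (s : I.H), M ∉ 𝔭.asIdeal ∧
            Literature.NumberTheory.EllipticCurves.Kato2004.IsEulerSystemClassTwo W hκ I s ∧ s ≠ 0 ∧
            M • s₀ = s) :=
  flatF3_package_of_levelCongruences_of_flatPrimitive W v hss hκ hγ hg hap I hrank L J hJ P loc hloc f ϖ Ls Lf hL hLf x A hd hE3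
    hcop hprim (padicValRat_periodRatio_nonneg_of_goodSS_two_of_abbesUllmo hAU W hss f hf ϖ hϖΩ)

/-- ★★ **F3a ∧ F3b ∧ ZL2 with Z6's `h2` kept and `(t, ht)` DISCHARGED by Abbes–Ullmo**: Z6 with `(t : ℤ_[2]) (ht : ↑t = ϖ·d)`
replaced by `hf : IsNewformOf W f`, `hϖΩ : (ϖ : ℝ) * W.realPeriodRat = plusPeriod f` and the print fact `hAU` (via B1b's
`flatF3_package_of_levelCongruences_of_padicValRat_nonneg`). [cite: AbbesUllmo1996, Thm. A] [cite: Kato2004Asterisque, Thm. 12.4–12.6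
(pp. 221–222), §13.9–13.14 (pp. 230–234)] [cite: Sprung2017, Thm. 1.12, Cor. 4.4–4.5] -/
theorem flatF3_package_of_levelCongruences_of_abbesUllmo
    (hAU : abbesUllmo_not_dvd_maninConstant_of_not_dvd_level) (hss : GoodSS W 2) (hκ : κ.IsCyclotomic)
    (hγ : κ.IsTopGenerator γ)
    (hg : κ.IsTopGenerator (resGalOfEmb (closureEmb (K := ℚ) (v.adicCompletion ℚ)) g)) {ap : ℤ} (hap : (2 : ℤ) ∣ ap)
    (I : Kato2004.IwasawaH1Data W 2 κ γ) (hrank : Module.rank (IwasawaAlgebra 2) I.H ≤ 1)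
    (L : letI := moduleOfGenerator κ (closureEmb (K := ℚ) (v.adicCompletion ℚ)) W hg
      I.H →ₗ[IwasawaAlgebra 2] (localTowerPointsOfEmb κ (closureEmb (K := ℚ) (v.adicCompletion ℚ)) W →+ ℤ_[2]))
    (J : letI := moduleOfGenerator κ (closureEmb (K := ℚ) (v.adicCompletion ℚ)) W hg
      (localTowerPointsOfEmb κ (closureEmb (K := ℚ) (v.adicCompletion ℚ)) W →+ ℤ_[2]) →ₗ[IwasawaAlgebra 2]
        IwasawaAlgebra 2 × IwasawaAlgebra 2)
    (hJ : ∀ w, IsColemanPair κ (closureEmb (K := ℚ) (v.adicCompletion ℚ)) W ap g c w (J w).1 (J w).2)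
    (P : Submodule (IwasawaAlgebra 2) (IwasawaAlgebra 2)) (loc : I.H →ₗ[IwasawaAlgebra 2] P)
    (hloc : ∀ x : I.H, (loc x : IwasawaAlgebra 2) = (J (L x)).2)
    {N : ℕ} [NeZero N] (f : CuspForm (Gamma0 N) 2) (hf : IsNewformOf W f) (ϖ : ℚ)
    (hϖΩ : (ϖ : ℝ) * W.realPeriodRat = plusPeriod f)
    (Ls Lf : IwasawaAlgebra 2) (hL : IsSprungPair f 2 ap Ls Lf) (hLf : Lf ≠ 0)
    {ι : Type*} (x : ι → I.H) (A : ι → IwasawaAlgebra 2) {d : ℤ_[2]} (hd : d ≠ 0)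
    (hE3 : ∀ (i : ι) (n : ℕ), ∃ (m : ℕ) (q : IwasawaAlgebra 2), PowerSeries.C ((2 : ℚ_[2]) ^ m) *
        (iwasawaToPowerSeries 2 (A i) * (((mazurTateElement f 2 n).map (algebraMap ℚ ℚ_[2]) : ℚ_[2][X]) : PowerSeries ℚ_[2]) -
          iwasawaToPowerSeries 2 (PowerSeries.C d *
            pairingSum W (localTowerPointsOfEmb κ (closureEmb (K := ℚ) (v.adicCompletion ℚ)) W) g n (c n) (L (x i)))) =
      iwasawaToPowerSeries 2 ((((cyclotomicOmega 2 n).map (Int.castRingHom ℤ_[2]) : ℤ_[2][X]) : PowerSeries ℤ_[2]) * q))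
    (hcop : ∀ 𝔭 : PrimeSpectrum (IwasawaAlgebra 2), 𝔭.asIdeal.height = 1 →
      PowerSeries.C (2 : ℤ_[2]) ∉ 𝔭.asIdeal → ∃ i, A i ∉ 𝔭.asIdeal ∧
        Literature.NumberTheory.EllipticCurves.Kato2004.IsEulerSystemClassTwo W hκ I (x i) ∧ x i ≠ 0)
    (h2 : ∀ 𝔭 : PrimeSpectrum (IwasawaAlgebra 2), 𝔭.asIdeal.height = 1 →
      PowerSeries.C (2 : ℤ_[2]) ∈ 𝔭.asIdeal → ∃ i, A i ∉ 𝔭.asIdeal) :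
    ∃ (Z : Submodule (IwasawaAlgebra 2) I.H) (G : IwasawaAlgebra 2),
      G ∈ Submodule.map (P.subtype ∘ₗ loc) Z ∧
      iwasawaToPowerSeries 2 G = PowerSeries.C (ϖ : ℚ_[2]) * iwasawaToPowerSeries 2 Lf ∧
      (∃ s₀ : I.H, Z = Submodule.span (IwasawaAlgebra 2) {s₀} ∧
        ∀ 𝔭 : PrimeSpectrum (IwasawaAlgebra 2), 𝔭.asIdeal.height = 1 →
          PowerSeries.C (2 : ℤ_[2]) ∉ 𝔭.asIdeal →
          ∃ (M : IwasawaAlgebra 2) (s : I.H), M ∉ 𝔭.asIdeal ∧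
            Literature.NumberTheory.EllipticCurves.Kato2004.IsEulerSystemClassTwo W hκ I s ∧ s ≠ 0 ∧
            M • s₀ = s) :=
  flatF3_package_of_levelCongruences_of_padicValRat_nonneg W v hss hκ hγ hg hap I hrank L J hJ P loc hloc f ϖ Ls Lf hL hLf x A hd hE3
    hcop h2 (padicValRat_periodRatio_nonneg_of_goodSS_two_of_abbesUllmo hAU W hss f hf ϖ hϖΩ)

end Habitat

end SSFlatERL

end Summit.BirchSwinnertonDyer.BirchSwinnertonDyer.Theorems

end
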